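import Literature.MathematicalPhysics.QuantumFieldTheory.Balaban1983to89.B9SectBGpReadingsY
import Literature.MathematicalPhysics.QuantumFieldTheory.Balaban1983to89.Node00.OpsYRead342Cross

/-!
# `Balaban1983to89.B9SectBGpTransferInY` — the INPUT HALF of the transfer between the record's (3.42) readings of G′ and the augmented coded readings
# `KSC`: at a regular base `U`, print's four sup entries `|G′λ|, |∇_UG′λ|, |G′∇*_Uλ|, |Δ_UG′λ|` bound the two CROSS entries `|∇*_UG′λ|` (left-backward) and
# `|G′∇_Uλ|` (right-forward), hence the (3.42) block of `KSC` at `base U` — with constants depending on `(δ₀, L, d)` and the neighbourhood count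

T. Bałaban, *Propagators for lattice gauge theories in a background field*, Commun. Math. Phys. **99** (1985) 389–434
[`Balaban1985BackgroundPropagators`, "B9"]; [4] = T. Bałaban, *Propagators and renormalization transformations for lattice gauge
theories. II*, Commun. Math. Phys. **96** (1984) 223–250 [`Balaban1984PropagatorsII`].

statement-level skeleton of published theorems with citation tags; proofs where landed; nothing here is a claim about the
Yang–Mills mass gap

THE PRINTED LOCI.  Thm 3.1 (3.42) p. 397 (the four sup entries, «for x ∈ Δ(y), y ∈ Λ_j, supp λ ⊂ Δ(y′)»); (3.3) p. 390 (∇_U), (3.5) p. 391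
(`U(x, x−e_μ) = U(x−e_μ, x)⁻¹`), (3.8) p. 392 (∇*_U); (3.35) p. 396 («U has values in G»); [4] (2.2) p. 224 + (2.46) p. 231 (neighbouring blocks are at
bounded distance and adjacent levels), Lemma 2.1 (2.61) p. 234 (the neighbourhood count).

WHY THIS FILE (pub-ymgap N06 row 13, seat dag-n06-c gen 7).  The root Sect.-B frame is inhabited over the coded carrier at the AUGMENTED readings
`B9SectBGpReadingsY.KSC` (entries 1∕2 = max over BOTH covariant differences); `B9.SectBStepPrinted` for `KSC` becomes `B9.SectBStepPrinted` for the
record's `pullK (codingYx …) (kernelFamilyS …)` by `B9SectBStepFamilyTransfer.sectBStepPrinted_of_family`, whose hypothesis `hin` asks: at a regular INPUT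
`U`, the record's block `Thms31to33IneqAt … (pullK K) … (base U)` implies `Thms31to33IneqAt … KSC … (base U)` with new constants (an M-threshold
allowed).  Print's (3.42) has `∇_UG′` and `G′∇*_U` only; the two cross entries follow from them AT THE SAME `U` by two EXACT identities of the covariant
differences over a `G`-valued (unit-norm) configuration:
* LEFT-backward: `(∇*_μg)(x) = −R(U_μ(x−e_μ))⁻¹(∇_μg)(x−e_μ)` ((3.8) with (3.5); `B9Eq371Composition.covDstar_eq_neg_R_covD`) — the entry is read at the
  NEIGHBOUR block of `x − e_μ` (distance `≦ 2(d+1)`, level `±1`: `B9SectBGpLettersY.stencilB_blkC`, `B9RWSumsCompleteGeo9YNbr.len_le_of_dist_lt_M_geo9K`),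
  cost `L·e^{|δ|·2(d+1)}`;
* RIGHT-forward: `∇_μ = −∇*_μ∘T_μ` (`T_μ` the covariant transport-shift; equivalently `∇_μ = −∇*_μ − ∇*_μ∇_μ`): the transported input `T_μ(f ⊗ E)` is
  expanded in the basis `b` and split over the blocks it meets — at most the neighbourhood count `#{y″ : d(y″, y′) ≦ 2(d+1)} ≦ mN` of
  `B9GeoNbrCountKLevelV1` (an M-threshold at the record) — cost `mN·M₂(Σ‖b_j‖)·e^{|δ|·2(d+1)}`.
The two cross entries themselves, pointwise and generic over NODE 00's readings, are def-Y's `Node00.OpsYRead342Cross` (`eta_mul_norm_cdsS_O_le_of_eBlock`,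
`eta_mul_norm_O_cdS_le_of_eBlock` — USED BY NAME; the right-forward one there goes through `∇_μ = −∇*_μ∘T_μ`).
CONTENTS: §1 ★ `kernelFamilySC_e_le_of_pw` (six pointwise bounds ⇒ the augmented entry) and ★★ `eBlock_KSC_base` : `EBlock (record G′ family) B₀ δ U →
EBlock (KSC …) (c_in(δ)·max B₀ 0) δ (base U)`, `c_in(δ) = L·e^{|δ|·2(d+1)} + mN·M₂(Σ‖b_j‖)·e^{|δ|·2(d+1)} + 1`;
§2 ★★ `thms_KSC_base_of_pullK` — the `hin` estimate of the transfer at one regular `U` (the Hölder ∕ L² ∕ global members and the `GA`, `Cinv` blocks are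
the same terms on both sides; `B₀ ↦ B₀′ ≧ B₀` by monotonicity); §3 ★★★ `hin_KSC` — the hypothesis `hin` of `B9SectBStepFamilyTransfer.sectBStepPrinted_of_family`
LITERALLY, over def-Y's members (M-threshold = the neighbourhood count's `ML` ∨ `2(d+1) + 1`; constants `(c_in(δ₀)·max B₀ 0, δ₀, B_β, B_ε, B_εβ, B₁, δ₁)`).

HONEST SCOPE.  Bookkeeping over NODE 00's DEFINED readings plus two three-line identities; no estimate of [B9] is proved or asserted (the (3.42) block is
the HYPOTHESIS on both sides); the OUTPUT half of the transfer (letters `U ↦ U′U` at the class (3.37), print p. 403 «of course with different constants»)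
is NOT here; the block labels `ιB` are a SECTION of `β` (`hι`), which exists exactly at the
CORNER-FREE members (`B9BetaRangeKLevelV1.surjective_beta_iff`) — at a cornered member every statement displaying `hι` is vacuous (ref-E READ-1∕10; a
quasi-section at bounded distance would serve the same estimates with larger constants, not done); COUNT-NEUTRAL; N06 NOT discharged; one finite lattice programme — nothing continuum ∕ OS ∕ mass-gap ∕ Clay.  Cell `pub-ymgap` (HUMAN RULING
D-0062), Track A node N06 [B9], N06-ASSIGNMENT row 13, 2026-08-27.

RELATED IN THE TREE, NOT DUPLICATED: `Node00.OpsYRead342` (def-Y: the four same-configuration pointwise reads `sq_eta_mul_norm_le_of_eBlock`,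
`eta_mul_norm_cdS_le_of_eBlock`, `eta_mul_norm_cdsS_le_of_eBlock`, `norm_lapS_le_of_eBlock`) and `Node00.OpsYRead342Cross` (def-Y: the two cross reads) — USED BY
NAME, `B9SectBGpReadingsY` (`KSC`, `kernelFamilySC`, `write342Y_KSC`'s entrywise writing, here factored as `kernelFamilySC_e_le_of_pw`),
`B9RWSumsReadsNbr.nbr`, `B9GeoNbrCountKLevelV1.exists_card_nbr_geo9Y_le_of_M` (the count above its M-threshold), `B9SectBStepFamilyTransfer` (the consumer of §5).
-/

noncomputable section

namespace Literature.MathematicalPhysics.QuantumFieldTheory.Balaban1983to89.B9SectBGpTransferInY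

variable {𝔸 : Type} [NormedRing 𝔸] [NormedAlgebra ℂ 𝔸]

/-! ## §1 Writing the augmented entries from six pointwise bounds; the (3.42) block of `KSC` at a regular base -/

section Write

open Literature.MathematicalPhysics.QuantumFieldTheory.Balaban1983to89.B6KLevelCensusIndexV1 (KIdx kGeo)
open Literature.MathematicalPhysics.QuantumFieldTheory.Balaban1983to89.B6Ineq2142KLevelV1 (β)
open Literature.MathematicalPhysics.QuantumFieldTheory.Balaban1983to89.B6Prop22KLevelCensusEta (epow)
open Literature.MathematicalPhysics.QuantumFieldTheory.Balaban1983to89.B9FromB6 (EBlock pref4_nonneg pref6_nonneg)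
open Literature.MathematicalPhysics.QuantumFieldTheory.Balaban1983to89.B9SectBCodedCarrier (CCfg pullK)
open Literature.MathematicalPhysics.QuantumFieldTheory.Balaban1983to89.B9Eq360DeltaPrimeAY (AfldY blkY blkY_apply)
open Literature.MathematicalPhysics.QuantumFieldTheory.Balaban1983to89.B9PinMembersKLevelV1 (MemberY geo9Y bg9Y)
open Literature.MathematicalPhysics.QuantumFieldTheory.Balaban1983to89.B9SectBGpLettersY (decY GVal blkC)
open Literature.MathematicalPhysics.QuantumFieldTheory.Balaban1983to89.B9SectBGpFrameCodedY (codingYx)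
open Literature.MathematicalPhysics.QuantumFieldTheory.Balaban1983to89.B9SectBGpReadingsY (baseY eLatSC kernelFamilySC kernelFamilySC_e_inl
  kernelFamilySC_e_inr KSC supNorm_nonneg)
open Literature.MathematicalPhysics.QuantumFieldTheory.Balaban1983to89.Node00 (SiteY BlkY IBondY CfgY BallY SiteOpY SiteParY UboxY shiftY cdS cdsS lapS
  etaS supBlkS supBlkS' kernelFamilyS liftY liftY_apply GpY)
open Literature.MathematicalPhysics.QuantumFieldTheory.Balaban1983to89.Node00.OpsYRead342 (sq_eta_mul_norm_le_of_eBlock eta_mul_norm_cdS_le_of_eBlock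
  eta_mul_norm_cdsS_le_of_eBlock norm_lapS_le_of_eBlock)
open Literature.MathematicalPhysics.QuantumFieldTheory.Balaban1983to89.Node00.OpsYRead342Cross (eta_mul_norm_cdsS_O_le_of_eBlock eta_mul_norm_O_cdS_le_of_eBlock)
open Literature.MathematicalPhysics.QuantumFieldTheory.Balaban1983to89.B9SectBGpLettersY (norm_le_one_and_inv_of_mem)
open Literature.MathematicalPhysics.QuantumFieldTheory.Balaban1983to89.B9RWSumsReadsNbr (nbr)
open Literature.MathematicalPhysics.QuantumFieldTheory.Balaban1983to89.B9GeoNormsKLevelV1 (geo9K_supNorm_nonneg geo9K_l2Norm_nonneg geo9K_wNorm_nonneg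
  geo9K_cutSup_nonneg)

variable {d ℓ : ℕ} {hd : 1 ≤ d + 1} {hL : Odd (ℓ + 1) ∧ 1 < ℓ + 1} {b₀ b₁ : ℝ} [CompleteSpace 𝔸]

/-- ★ **SIX POINTWISE BOUNDS WRITE THE AUGMENTED ENTRY**: if, for every direction `E` of the ball and every site `w` of the block `β(bb)`, the six
quantities `η²‖O(V)Λ(w)‖`, `η‖∇_{U₀,μ}O(V)Λ(w)‖`, `η‖∇*_{U₀,μ}O(V)Λ(w)‖`, `η‖O(V)∇_{U₀,μ}Λ(w)‖`, `η‖O(V)∇*_{U₀,μ}Λ(w)‖`, `‖Δ_{U₀}O(V)Λ(w)‖` (`Λ = f ⊗ E`) are below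
`C·[t², t, t, t, t, 1]·ex·B′`, then the entry `n` of `kernelFamilySC` at a configuration decoding to (base `U₀`, operator at `V`) is below `C·pref4(t)(n)·ex·B′`
(the entrywise writing of `B9SectBGpReadingsY.write342Y_KSC`, factored). [cite: Balaban1985BackgroundPropagators, (3.42) p.397, bookkeeping] -/
theorem kernelFamilySC_e_le_of_pw (i : KIdx d ℓ hd hL b₀ b₁) (B : B9.Backgrounds) (cfg : B.Cfg → CCfg (CfgY 𝔸 i) (AfldY 𝔸 i)) (O : SiteOpY 𝔸 i)
    (par : SiteParY 𝔸 i) (c : B.Cfg) {U₀ V : CfgY 𝔸 i} (hU₀ : baseY i (cfg c) = U₀) (hV : decY i (cfg c) = V) (n : Fin 4) (f : SiteY i → ℝ)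
    (bb : IBondY i) {C t ex B' : ℝ} (hC : 0 ≤ C) (ht : 0 ≤ t) (hex : 0 ≤ ex) (hB' : 0 ≤ B')
    (hpw : ∀ (E : BallY 𝔸) (w : SiteY i), B6Geom246MultiLevelBox.blkOf i.D.toDomains w = β i.hN i.D i.hk bb →
        etaS i ^ 2 * ‖O V (liftY f (E : 𝔸)) w‖ ≤ C * (t ^ 2 * ex) * B' ∧
        (∀ μ, etaS i * ‖cdS i U₀ μ (O V (liftY f (E : 𝔸))) w‖ ≤ C * (t * ex) * B') ∧
        (∀ μ, etaS i * ‖cdsS i U₀ μ (O V (liftY f (E : 𝔸))) w‖ ≤ C * (t * ex) * B') ∧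
        (∀ μ, etaS i * ‖O V (cdS i U₀ μ (liftY f (E : 𝔸))) w‖ ≤ C * (t * ex) * B') ∧
        (∀ μ, etaS i * ‖O V (cdsS i U₀ μ (liftY f (E : 𝔸))) w‖ ≤ C * (t * ex) * B') ∧
        ‖lapS i U₀ (O V (liftY f (E : 𝔸))) w‖ ≤ C * (1 * ex) * B') :
    (kernelFamilySC i B cfg O par).e n c (.inl f) bb ≤ C * B9.pref4 t n * ex * B' := by
  rw [kernelFamilySC_e_inl, hU₀, hV]
  set η := etaS i with hη
  have hη0 : 0 < η := B9Ineq349SiteComposite.etaS_pos i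
  set s₀ := β i.hN i.D i.hk bb with hs₀
  have hdir : ∀ E : BallY 𝔸, η ^ (epow n) * eLatSC i O U₀ V (liftY f (E : 𝔸)) s₀ n ≤ C * B9.pref4 t n * ex * B' := by
    intro E
    set Λ₀ := liftY f (E : 𝔸) with hΛ₀
    match n with
    | 0 =>
      show η ^ 2 * supBlkS i s₀ (O V Λ₀) ≤ C * t ^ 2 * ex * B'
      have hc : 0 ≤ C * t ^ 2 * ex * B' / η ^ 2 := by positivity
      have hs : supBlkS i s₀ (O V Λ₀) ≤ C * t ^ 2 * ex * B' / η ^ 2 :=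
        B9Ineq349SiteComposite.supBlkS_le i _ _ hc fun w hw => by
          rw [le_div_iff₀ (by positivity), mul_comm]; exact ((hpw E w hw).1).trans (le_of_eq (by ring))
      calc η ^ 2 * supBlkS i s₀ (O V Λ₀) ≤ η ^ 2 * (C * t ^ 2 * ex * B' / η ^ 2) := mul_le_mul_of_nonneg_left hs (by positivity)
        _ = _ := mul_div_cancel₀ _ (by positivity)
    | 1 =>
      show η ^ 1 * max (supBlkS' i s₀ (fun μ => cdS i U₀ μ (O V Λ₀))) (supBlkS' i s₀ (fun μ => cdsS i U₀ μ (O V Λ₀))) ≤ C * t * ex * B'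
      rw [pow_one]
      have hc : 0 ≤ C * t * ex * B' / η := by positivity
      have hs : max (supBlkS' i s₀ (fun μ => cdS i U₀ μ (O V Λ₀))) (supBlkS' i s₀ (fun μ => cdsS i U₀ μ (O V Λ₀))) ≤ C * t * ex * B' / η :=
        max_le
          (B9Ineq349SiteComposite.supBlkS'_le i _ _ hc fun w μ hw => by
            rw [le_div_iff₀ hη0, mul_comm]; exact ((hpw E w hw).2.1 μ).trans (le_of_eq (by ring)))
          (B9Ineq349SiteComposite.supBlkS'_le i _ _ hc fun w μ hw => by
            rw [le_div_iff₀ hη0, mul_comm]; exact ((hpw E w hw).2.2.1 μ).trans (le_of_eq (by ring)))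
      calc η * max _ _ ≤ η * (C * t * ex * B' / η) := mul_le_mul_of_nonneg_left hs hη0.le
        _ = _ := mul_div_cancel₀ _ hη0.ne'
    | 2 =>
      show η ^ 1 * max (supBlkS' i s₀ (fun μ => O V (cdS i U₀ μ Λ₀))) (supBlkS' i s₀ (fun μ => O V (cdsS i U₀ μ Λ₀))) ≤ C * t * ex * B'
      rw [pow_one]
      have hc : 0 ≤ C * t * ex * B' / η := by positivity
      have hs : max (supBlkS' i s₀ (fun μ => O V (cdS i U₀ μ Λ₀))) (supBlkS' i s₀ (fun μ => O V (cdsS i U₀ μ Λ₀))) ≤ C * t * ex * B' / η :=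
        max_le
          (B9Ineq349SiteComposite.supBlkS'_le i _ _ hc fun w μ hw => by
            rw [le_div_iff₀ hη0, mul_comm]; exact ((hpw E w hw).2.2.2.1 μ).trans (le_of_eq (by ring)))
          (B9Ineq349SiteComposite.supBlkS'_le i _ _ hc fun w μ hw => by
            rw [le_div_iff₀ hη0, mul_comm]; exact ((hpw E w hw).2.2.2.2.1 μ).trans (le_of_eq (by ring)))
      calc η * max _ _ ≤ η * (C * t * ex * B' / η) := mul_le_mul_of_nonneg_left hs hη0.le
        _ = _ := mul_div_cancel₀ _ hη0.ne'
    | 3 =>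
      show η ^ 0 * supBlkS i s₀ (lapS i U₀ (O V Λ₀)) ≤ C * 1 * ex * B'
      rw [pow_zero, one_mul]
      exact B9Ineq349SiteComposite.supBlkS_le i _ _ (by positivity) fun w hw => ((hpw E w hw).2.2.2.2.2).trans (le_of_eq (by ring))
  have hηn : 0 < η ^ (epow n) := pow_pos hη0 _
  have hP : 0 ≤ C * B9.pref4 t n * ex * B' := mul_nonneg (mul_nonneg (mul_nonneg hC (pref4_nonneg ht n)) hex) hB'
  have hsup : (⨆ E : BallY 𝔸, eLatSC i O U₀ V (liftY f (E : 𝔸)) s₀ n) ≤ C * B9.pref4 t n * ex * B' / η ^ (epow n) :=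
    Node00.iSup_ball_le (fun E => by rw [le_div_iff₀ hηn, mul_comm]; exact hdir E) (div_nonneg hP hηn.le)
  calc η ^ (epow n) * (⨆ E : BallY 𝔸, eLatSC i O U₀ V (liftY f (E : 𝔸)) s₀ n) ≤ η ^ (epow n) * (C * B9.pref4 t n * ex * B' / η ^ (epow n)) :=
      mul_le_mul_of_nonneg_left hsup hηn.le
    _ = _ := mul_div_cancel₀ _ hηn.ne'

/-- the (3.42) block is monotone in its constant (all its factors are nonnegative at the record geometry). [cite: Balaban1985BackgroundPropagators, (3.42) p.397, bookkeeping] -/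
theorem eBlock_mono (i : KIdx d ℓ hd hL b₀ b₁) {B : B9.Backgrounds} (K : B9.KernelFamily (B9GeoNormsKLevelV1.geo9K i) B) {B₀ B₀' δ : ℝ} {U : B.Cfg}
    (hle : B₀ ≤ B₀') (h : EBlock K B₀ δ U) : EBlock K B₀' δ U := by
  intro n lam y y' hs
  refine (h n lam y y' hs).trans ?_
  have h1 : 0 ≤ B9.pref4 ((B9GeoNormsKLevelV1.geo9K i).len y) n := pref4_nonneg (B6KLevelCensusIndexV1.len_pos i y).le n
  have h2 := geo9K_supNorm_nonneg i lam
  have h3 := (Real.exp_pos (-(δ * (B9GeoNormsKLevelV1.geo9K i).dist y y'))).le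
  gcongr

variable {Mstar : ℕ} (G : Subgroup 𝔸ˣ) (x : MemberY d ℓ hd hL b₀ b₁ Mstar) (par : SiteParY 𝔸 x.toKIdx) {ι : Type} [Fintype ι]
  (b : Module.Basis ι ℝ 𝔸) (ιB : BlkY x.toKIdx → IBondY x.toKIdx) (C37 C38 : ℝ → CfgY 𝔸 x.toKIdx → AfldY 𝔸 x.toKIdx → Prop)

/-- ★★ **THE (3.42) BLOCK OF THE AUGMENTED READINGS AT A REGULAR BASE, FROM THE RECORD'S**: at a `G`-valued `U`, the record's block
`EBlock (kernelFamilyS … (GpY par) par) B₀ δ U` gives `EBlock (KSC …) (c_in·max B₀ 0) δ (base U)` with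
`c_in = L·e^{|δ|·2(d+1)} + 1 + 2M₂(Σ‖b_j‖)·mN·e^{|δ|·2(d+1)}` (an M-threshold `2(d+1) < M` and the neighbourhood count `mN` displayed).
[cite: Balaban1985BackgroundPropagators, Thm 3.1 (3.42) p.397, (3.3) p.390, (3.8) p.392; Balaban1984PropagatorsII, Lemma 2.1 (2.61) p.234, (2.51) p.232] -/
theorem eBlock_KSC_base [Fintype (geo9Y x).Site] (hι : ∀ s : BlkY x.toKIdx, β x.toKIdx.hN x.toKIdx.D x.toKIdx.hk (ιB s) = s)
    (hG1 : ∀ u : 𝔸ˣ, u ∈ G → ‖(u : 𝔸)‖ ≤ 1) {U : CfgY 𝔸 x.toKIdx} (hU : GVal G x.toKIdx U) {B₀ δ : ℝ}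
    (hE : EBlock (kernelFamilyS x.toKIdx (bg9Y 𝔸 G x) (fun U => U) (GpY x.toKIdx par) par) B₀ δ U)
    {M₂ : ℝ} (hM₂ : 0 ≤ M₂) (hrepr : ∀ (v : 𝔸) (j : ι), |b.repr v j| ≤ M₂ * ‖v‖) (hM : 2 * ((d : ℝ) + 1) < (geo9Y x).M)
    {mN : ℕ} (hN : ∀ a : IBondY x.toKIdx, (nbr (geo9Y x) (2 * ((d : ℝ) + 1)) a).card ≤ mN) :
    EBlock (KSC G x par C37 C38)
      ((((ℓ + 1 : ℕ) : ℝ) * Real.exp (|δ| * (2 * ((d : ℝ) + 1))) + ((mN : ℝ) * (M₂ * ∑ j, ‖b j‖) * Real.exp (|δ| * (2 * ((d : ℝ) + 1))) + 1))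
        * max B₀ 0) δ (.base U) := by
  set cL : ℝ := ((ℓ + 1 : ℕ) : ℝ) * Real.exp (|δ| * (2 * ((d : ℝ) + 1))) with hcL
  set cR : ℝ := (mN : ℝ) * (M₂ * ∑ j, ‖b j‖) * Real.exp (|δ| * (2 * ((d : ℝ) + 1))) + 1 with hcR
  set B₁ := max B₀ 0 with hB₁
  have hB₁ : 0 ≤ B₁ := le_max_right _ _
  have hE' := eBlock_mono x.toKIdx _ (le_max_left B₀ 0) hE
  have hU1 : ∀ (μ : Fin (d + 1)) (w : SiteY x.toKIdx), ‖((UboxY x.toKIdx U μ w : 𝔸ˣ) : 𝔸)‖ ≤ 1 ∧ ‖(((UboxY x.toKIdx U μ w)⁻¹ : 𝔸ˣ) : 𝔸)‖ ≤ 1 :=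
    fun μ w => norm_le_one_and_inv_of_mem G hG1 (hU μ _)
  have hSb : 0 ≤ ∑ j, ‖b j‖ := Finset.sum_nonneg fun _ _ => norm_nonneg _
  have h1L : 1 ≤ cL := by
    have h1 : (1 : ℝ) ≤ ((ℓ + 1 : ℕ) : ℝ) := by exact_mod_cast Nat.succ_le_succ (Nat.zero_le ℓ)
    have h2 : (1 : ℝ) ≤ Real.exp (|δ| * (2 * ((d : ℝ) + 1))) := Real.one_le_exp (by positivity)
    nlinarith
  have hcR1 : 0 ≤ (mN : ℝ) * (M₂ * ∑ j, ‖b j‖) * Real.exp (|δ| * (2 * ((d : ℝ) + 1))) := by positivity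
  have h1R : 1 ≤ cR := by rw [hcR]; linarith
  have hcL0 : 0 ≤ cL := zero_le_one.trans h1L
  have hcR0 : 0 ≤ cR := zero_le_one.trans h1R
  have hCR' : (mN : ℝ) * (M₂ * ∑ j, ‖b j‖) * Real.exp (|δ| * (2 * ((d : ℝ) + 1))) * B₁ ≤ (cL + cR) * B₁ := by
    rw [hcR]; nlinarith [mul_nonneg hcL0 hB₁, hB₁]
  have hC1 : B₁ ≤ (cL + cR) * B₁ := by nlinarith
  have hCL : cL * B₁ ≤ (cL + cR) * B₁ := by nlinarith
  have hCR : cR * B₁ ≤ (cL + cR) * B₁ := by nlinarith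
  intro n lam y y' hs
  have hlen : 0 ≤ (geo9Y x).len y := (B9GeoLemma21KLevelV1.geo9Y_len_pos x y).le
  have hRHS : 0 ≤ (cL + cR) * B₁ * B9.pref4 ((geo9Y x).len y) n * Real.exp (-(δ * (geo9Y x).dist y y')) * (geo9Y x).supNorm lam := by
    have := supNorm_nonneg x lam
    have := pref4_nonneg hlen n
    positivity
  cases lam with
  | inr J => rw [KSC, kernelFamilySC_e_inr]; exact hRHS
  | inl f =>
    set ex := Real.exp (-(δ * (geo9Y x).dist y y')) with hex
    set N := (geo9Y x).supNorm (.inl f) with hN'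
    have hN0 : 0 ≤ N := supNorm_nonneg x _
    have hex0 : 0 ≤ ex := (Real.exp_pos _).le
    rw [KSC]
    refine kernelFamilySC_e_le_of_pw x.toKIdx (codingYx G x C37 C38).bg (fun c => c) (GpY x.toKIdx par) par (.base U) rfl rfl n f y
      (mul_nonneg (add_nonneg hcL0 hcR0) hB₁) hlen hex0 hN0 fun E w hw => ?_
    have hE1 : ‖(E : 𝔸)‖ ≤ 1 := mem_closedBall_zero_iff.1 E.2
    have hX : 0 ≤ (geo9Y x).len y * ex * N := by positivity
    have hX2 : 0 ≤ (geo9Y x).len y ^ 2 * ex * N := by positivity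
    have hX0 : 0 ≤ ex * N := by positivity
    refine ⟨?_, fun μ => ?_, fun μ => ?_, fun μ => ?_, fun μ => ?_, ?_⟩
    · have h := sq_eta_mul_norm_le_of_eBlock x.toKIdx b (B := bg9Y 𝔸 G x) (fun U => U) (GpY x.toKIdx par) par (U₁ := U) (B₀ := B₁) (δ := δ) hE'
        hM₂ hrepr f y y' hs hE1 hw
      calc _ ≤ B₁ * (geo9Y x).len y ^ 2 * ex * N := h
        _ = B₁ * ((geo9Y x).len y ^ 2 * ex * N) := by ring
        _ ≤ (cL + cR) * B₁ * ((geo9Y x).len y ^ 2 * ex * N) := mul_le_mul_of_nonneg_right hC1 hX2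
        _ = _ := by ring
    · have h := eta_mul_norm_cdS_le_of_eBlock x.toKIdx b (B := bg9Y 𝔸 G x) (fun U => U) (GpY x.toKIdx par) par (U₁ := U) (B₀ := B₁) (δ := δ) hE'
        hM₂ hrepr f y y' hs hE1 μ hw
      calc _ ≤ B₁ * (geo9Y x).len y * ex * N := h
        _ = B₁ * ((geo9Y x).len y * ex * N) := by ring
        _ ≤ (cL + cR) * B₁ * ((geo9Y x).len y * ex * N) := mul_le_mul_of_nonneg_right hC1 hX
        _ = _ := by ring
    · have h := eta_mul_norm_cdsS_O_le_of_eBlock x.toKIdx b (B := bg9Y 𝔸 G x) (fun U => U) (GpY x.toKIdx par) par (U₁ := U) (B₀ := B₁) (δ := δ) ιB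
        hE' hB₁ hι hM₂ hrepr hU1 hM f y y' hs hE1 μ hw
      calc _ ≤ cL * (B₁ * (geo9Y x).len y * ex * N) := by rw [hcL]; exact h
        _ = cL * B₁ * ((geo9Y x).len y * ex * N) := by ring
        _ ≤ (cL + cR) * B₁ * ((geo9Y x).len y * ex * N) := mul_le_mul_of_nonneg_right hCL hX
        _ = _ := by ring
    · letI : Fintype (B9GeoNormsKLevelV1.geo9K x.toKIdx).Site := ‹Fintype (geo9Y x).Site›
      have h := eta_mul_norm_O_cdS_le_of_eBlock x.toKIdx b (B := bg9Y 𝔸 G x) (fun U => U) (GpY x.toKIdx par) par (U₁ := U) (B₀ := B₁) (δ := δ) ιB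
        hE' hB₁ hι hM₂ hrepr hU1 hN f y y' hs hE1 μ hw
      calc _ ≤ (mN : ℝ) * (M₂ * ∑ j, ‖b j‖) * Real.exp (|δ| * (2 * ((d : ℝ) + 1))) * (B₁ * (geo9Y x).len y * ex * N) := h
        _ = (mN : ℝ) * (M₂ * ∑ j, ‖b j‖) * Real.exp (|δ| * (2 * ((d : ℝ) + 1))) * B₁ * ((geo9Y x).len y * ex * N) := by ring
        _ ≤ (cL + cR) * B₁ * ((geo9Y x).len y * ex * N) := mul_le_mul_of_nonneg_right hCR' hX
        _ = _ := by ring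
    · have h := eta_mul_norm_cdsS_le_of_eBlock x.toKIdx b (B := bg9Y 𝔸 G x) (fun U => U) (GpY x.toKIdx par) par (U₁ := U) (B₀ := B₁) (δ := δ) hE'
        hM₂ hrepr f y y' hs hE1 μ hw
      calc _ ≤ B₁ * (geo9Y x).len y * ex * N := h
        _ = B₁ * ((geo9Y x).len y * ex * N) := by ring
        _ ≤ (cL + cR) * B₁ * ((geo9Y x).len y * ex * N) := mul_le_mul_of_nonneg_right hC1 hX
        _ = _ := by ring
    · have h := norm_lapS_le_of_eBlock x.toKIdx b (B := bg9Y 𝔸 G x) (fun U => U) (GpY x.toKIdx par) par (U₁ := U) (B₀ := B₁) (δ := δ) hE'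
        hM₂ hrepr f y y' hs hE1 hw
      calc _ ≤ B₁ * 1 * ex * N := h
        _ = B₁ * (ex * N) := by ring
        _ ≤ (cL + cR) * B₁ * (ex * N) := mul_le_mul_of_nonneg_right hC1 hX0
        _ = _ := by ring

end Write

/-! ## §2 The `hin` estimate of the family transfer at one regular base -/

section Hin

open Literature.MathematicalPhysics.QuantumFieldTheory.Balaban1983to89.B6KLevelCensusIndexV1 (KIdx kGeo)
open Literature.MathematicalPhysics.QuantumFieldTheory.Balaban1983to89.B6Ineq2142KLevelV1 (β)
open Literature.MathematicalPhysics.QuantumFieldTheory.Balaban1983to89.B9FromB6 (EBlock pref4_nonneg pref6_nonneg)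
open Literature.MathematicalPhysics.QuantumFieldTheory.Balaban1983to89.B9SectBCodedCarrier (CCfg pullK)
open Literature.MathematicalPhysics.QuantumFieldTheory.Balaban1983to89.B9Eq360DeltaPrimeAY (AfldY)
open Literature.MathematicalPhysics.QuantumFieldTheory.Balaban1983to89.B9PinMembersKLevelV1 (MemberY geo9Y bg9Y)
open Literature.MathematicalPhysics.QuantumFieldTheory.Balaban1983to89.B9SectBGpLettersY (GVal)
open Literature.MathematicalPhysics.QuantumFieldTheory.Balaban1983to89.B9SectBGpFrameCodedY (codingYx)
open Literature.MathematicalPhysics.QuantumFieldTheory.Balaban1983to89.B9SectBGpReadingsY (KSC supNorm_nonneg)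
open Literature.MathematicalPhysics.QuantumFieldTheory.Balaban1983to89.Node00 (SiteY BlkY IBondY CfgY SiteParY kernelFamilyS GpY)
open Literature.MathematicalPhysics.QuantumFieldTheory.Balaban1983to89.B9RWSumsReadsNbr (nbr)
open Literature.MathematicalPhysics.QuantumFieldTheory.Balaban1983to89.B9GeoNormsKLevelV1 (geo9K_supNorm_nonneg geo9K_l2Norm_nonneg geo9K_wNorm_nonneg
  geo9K_cutSup_nonneg)

variable {d ℓ : ℕ} {hd : 1 ≤ d + 1} {hL : Odd (ℓ + 1) ∧ 1 < ℓ + 1} {b₀ b₁ : ℝ} {Mstar : ℕ} [CompleteSpace 𝔸]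
  (G : Subgroup 𝔸ˣ) (x : MemberY d ℓ hd hL b₀ b₁ Mstar) (par : SiteParY 𝔸 x.toKIdx) {ι : Type} [Fintype ι]
  (b : Module.Basis ι ℝ 𝔸) (ιB : BlkY x.toKIdx → IBondY x.toKIdx) (C37 C38 : ℝ → CfgY 𝔸 x.toKIdx → AfldY 𝔸 x.toKIdx → Prop)

omit [Fintype ι] in
/-- the (3.42) ∕ (3.46) ∕ (3.47) block of ANY family over the coded carrier is monotone in its constant `B₀` (all factors nonnegative at the record
geometry). [cite: Balaban1985BackgroundPropagators, (3.42) + (3.46) + (3.47) pp.397–398, bookkeeping] -/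
theorem ineq342_346_347_mono (K : B9.KernelFamily (geo9Y x) (codingYx G x C37 C38).bg) {B₀ B₀' δ : ℝ} {c : (codingYx G x C37 C38).bg.Cfg}
    (hle : B₀ ≤ B₀') (h : B9.Ineq342_346_347 K B₀ δ c) : B9.Ineq342_346_347 K B₀' δ c := by
  refine ⟨fun n lam y y' hs => (h.1 n lam y y' hs).trans ?_, fun n lam hh y y' hc hs => (h.2.1 n lam hh y y' hc hs).trans ?_,
    fun n lam γ h4 h4' => (h.2.2 n lam γ h4 h4').trans ?_⟩
  · have h1 : 0 ≤ B9.pref4 ((geo9Y x).len y) n := pref4_nonneg (B9GeoLemma21KLevelV1.geo9Y_len_pos x y).le n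
    have h2 : 0 ≤ (geo9Y x).supNorm lam := geo9K_supNorm_nonneg x.toKIdx lam
    have h3 := (Real.exp_pos (-(δ * (geo9Y x).dist y y'))).le
    gcongr
  · have h1 : 0 ≤ B9.pref6 ((geo9Y x).len y) n := pref6_nonneg (B9GeoLemma21KLevelV1.geo9Y_len_pos x y).le n
    have h2 : 0 ≤ (geo9Y x).l2Norm lam := geo9K_l2Norm_nonneg x.toKIdx lam
    have h3 := (Real.exp_pos (-(δ * (geo9Y x).dist y y'))).le
    have h4 : 0 ≤ (geo9Y x).cutSup hh := geo9K_cutSup_nonneg x.toKIdx hh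
    gcongr
  · have h2 : 0 ≤ (geo9Y x).wNorm γ lam := geo9K_wNorm_nonneg x.toKIdx γ lam
    gcongr

/-- the record's (3.42) block at the base, from the block of the pulled-back family at `base U` (a re-reading: `(pullK 𝔠 K).e n (base U) = K.e n U`).
[cite: Balaban1985BackgroundPropagators, (3.42) p.397, bookkeeping] -/
theorem eBlock_of_pullK_base {U : CfgY 𝔸 x.toKIdx} {B₀ δ₀ : ℝ}
    (h : EBlock (pullK (codingYx G x C37 C38) (kernelFamilyS x.toKIdx (bg9Y 𝔸 G x) (fun U => U) (GpY x.toKIdx par) par)) B₀ δ₀ (.base U)) :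
    EBlock (kernelFamilyS x.toKIdx (bg9Y 𝔸 G x) (fun U => U) (GpY x.toKIdx par) par) B₀ δ₀ U := by
  intro n lam y y' hs
  exact h n lam y y' hs

/-- the five untouched members of the augmented readings ARE the record's at the decoded configuration (projections of the `with`-update).
[cite: Balaban1985BackgroundPropagators, (3.43)–(3.47) p.398, bookkeeping] -/
theorem KSC_members_base (U : CfgY 𝔸 x.toKIdx) :
    (KSC G x par C37 C38).h1 (.base U) = (kernelFamilyS x.toKIdx (bg9Y 𝔸 G x) (fun U => U) (GpY x.toKIdx par) par).h1 U ∧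
    (KSC G x par C37 C38).e4 (.base U) = (kernelFamilyS x.toKIdx (bg9Y 𝔸 G x) (fun U => U) (GpY x.toKIdx par) par).e4 U ∧
    (KSC G x par C37 C38).h2 (.base U) = (kernelFamilyS x.toKIdx (bg9Y 𝔸 G x) (fun U => U) (GpY x.toKIdx par) par).h2 U ∧
    (∀ n, (KSC G x par C37 C38).l2 n (.base U) = (kernelFamilyS x.toKIdx (bg9Y 𝔸 G x) (fun U => U) (GpY x.toKIdx par) par).l2 n U) ∧
    (∀ n, (KSC G x par C37 C38).glob n (.base U) = (kernelFamilyS x.toKIdx (bg9Y 𝔸 G x) (fun U => U) (GpY x.toKIdx par) par).glob n U) :=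
  ⟨rfl, rfl, rfl, fun _ => rfl, fun _ => rfl⟩

/-- the five untouched members of the pulled-back record family at a coded configuration. [cite: Balaban1985BackgroundPropagators, (3.43)–(3.47) p.398, bookkeeping] -/
theorem pullK_members_base (K : B9.KernelFamily (geo9Y x) (bg9Y 𝔸 G x)) (U : CfgY 𝔸 x.toKIdx) :
    (pullK (codingYx G x C37 C38) K).h1 (.base U) = K.h1 U ∧
    (pullK (codingYx G x C37 C38) K).e4 (.base U) = K.e4 U ∧
    (pullK (codingYx G x C37 C38) K).h2 (.base U) = K.h2 U ∧
    (∀ n, (pullK (codingYx G x C37 C38) K).l2 n (.base U) = K.l2 n U) ∧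
    (∀ n, (pullK (codingYx G x C37 C38) K).glob n (.base U) = K.glob n U) :=
  ⟨rfl, rfl, rfl, fun _ => rfl, fun _ => rfl⟩

omit [Fintype ι] in
/-- the Hölder block (3.43)–(3.45) only sees the members `h1`, `e4`, `h2` at the configuration: two families agreeing there satisfy it together.
[cite: Balaban1985BackgroundPropagators, (3.43)–(3.45) p.398, bookkeeping] -/
theorem ineq343_345_congr (K K' : B9.KernelFamily (geo9Y x) (codingYx G x C37 C38).bg) {c : (codingYx G x C37 C38).bg.Cfg}
    (hh1 : K.h1 c = K'.h1 c) (he4 : K.e4 c = K'.e4 c) (hh2 : K.h2 c = K'.h2 c) (Bβ Bε : ℝ → ℝ) (Bεβ : ℝ → ℝ → ℝ) (δ₀ : ℝ)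
    (h : B9.Ineq343_345 K Bβ Bε Bεβ δ₀ c) : B9.Ineq343_345 K' Bβ Bε Bεβ δ₀ c := by
  unfold B9.Ineq343_345 at h ⊢
  rw [← hh1, ← he4, ← hh2]
  exact h

/-- ★★ **THE `hin` ESTIMATE OF THE FAMILY TRANSFER AT ONE REGULAR BASE**: at a `G`-valued `U` (above the M-threshold `2(d+1) < M`, with the
neighbourhood count `mN`), the block `Thms31to33IneqAt` of the record's G′ family READ ALONG THE DECODING (`pullK`) at `base U` implies the same block
for the augmented readings `KSC`, with `B₀ ↦ c_in(δ₀)·max B₀ 0` and every other constant unchanged — the Hölder ∕ (3.44)–(3.45) ∕ L² ∕ global members of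
`KSC` ARE the record's at the decoded configuration, and the `GA`, `C` blocks are untouched (the former re-read at the larger constant).
[cite: Balaban1985BackgroundPropagators, Thms 3.1–3.3 (3.42)–(3.48) pp.397–399, (3.3) p.390, (3.8) p.392; Balaban1984PropagatorsII, Lemma 2.1 (2.61) p.234] -/
theorem thms_KSC_base_of_pullK [Fintype (geo9Y x).Site] (hι : ∀ s : BlkY x.toKIdx, β x.toKIdx.hN x.toKIdx.D x.toKIdx.hk (ιB s) = s)
    (hG1 : ∀ u : 𝔸ˣ, u ∈ G → ‖(u : 𝔸)‖ ≤ 1) {U : CfgY 𝔸 x.toKIdx} (hU : GVal G x.toKIdx U)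
    {M₂ : ℝ} (hM₂ : 0 ≤ M₂) (hrepr : ∀ (v : 𝔸) (j : ι), |b.repr v j| ≤ M₂ * ‖v‖) (hM : 2 * ((d : ℝ) + 1) < (geo9Y x).M)
    {mN : ℕ} (hN : ∀ a : IBondY x.toKIdx, (nbr (geo9Y x) (2 * ((d : ℝ) + 1)) a).card ≤ mN)
    (dC : ℕ) (GA : B9.KernelFamily (geo9Y x) (codingYx G x C37 C38).bg) (Cinv : B9.SiteKernel (geo9Y x) (codingYx G x C37 C38).bg)
    {B₀ δ₀ : ℝ} {Bβ Bε : ℝ → ℝ} {Bεβ : ℝ → ℝ → ℝ} {B₁ δ₁ : ℝ}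
    (h : B9.Thms31to33IneqAt dC (pullK (codingYx G x C37 C38) (kernelFamilyS x.toKIdx (bg9Y 𝔸 G x) (fun U => U) (GpY x.toKIdx par) par)) GA Cinv
      B₀ δ₀ Bβ Bε Bεβ B₁ δ₁ (.base U)) :
    B9.Thms31to33IneqAt dC (KSC G x par C37 C38) GA Cinv
      ((((ℓ + 1 : ℕ) : ℝ) * Real.exp (|δ₀| * (2 * ((d : ℝ) + 1))) + ((mN : ℝ) * (M₂ * ∑ j, ‖b j‖) * Real.exp (|δ₀| * (2 * ((d : ℝ) + 1))) + 1))
        * max B₀ 0) δ₀ Bβ Bε Bεβ B₁ δ₁ (.base U) := by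
  set cIn : ℝ := ((ℓ + 1 : ℕ) : ℝ) * Real.exp (|δ₀| * (2 * ((d : ℝ) + 1))) + ((mN : ℝ) * (M₂ * ∑ j, ‖b j‖) * Real.exp (|δ₀| * (2 * ((d : ℝ) + 1))) + 1)
    with hcIn
  set K := kernelFamilyS x.toKIdx (bg9Y 𝔸 G x) (fun U => U) (GpY x.toKIdx par) par with hK
  have hSb : 0 ≤ ∑ j, ‖b j‖ := Finset.sum_nonneg fun _ _ => norm_nonneg _
  have h1 : 1 ≤ cIn := by
    have h1 : (1 : ℝ) ≤ ((ℓ + 1 : ℕ) : ℝ) := by exact_mod_cast Nat.succ_le_succ (Nat.zero_le ℓ)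
    have h2 : (1 : ℝ) ≤ Real.exp (|δ₀| * (2 * ((d : ℝ) + 1))) := Real.one_le_exp (by positivity)
    have h3 : 0 ≤ (mN : ℝ) * (M₂ * ∑ j, ‖b j‖) * Real.exp (|δ₀| * (2 * ((d : ℝ) + 1))) := by positivity
    rw [hcIn]; nlinarith
  have hB : B₀ ≤ cIn * max B₀ 0 := by
    have hm : B₀ ≤ max B₀ 0 := le_max_left _ _
    have hm0 : 0 ≤ max B₀ 0 := le_max_right _ _
    nlinarith
  obtain ⟨⟨h42, h43⟩, hC, ⟨g42, g43⟩⟩ := h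
  have h42' := ineq342_346_347_mono G x C37 C38 _ hB h42
  -- the member identities at the base: both sides are the record's members at `U`
  have mK := KSC_members_base G x par C37 C38 U
  have mP := pullK_members_base G x C37 C38 K U
  refine ⟨⟨⟨?_, ?_, ?_⟩, ?_⟩, hC, ⟨ineq342_346_347_mono G x C37 C38 GA hB g42, g43⟩⟩
  · -- the (3.42) block: the two cross entries
    exact eBlock_KSC_base G x par b ιB C37 C38 hι hG1 hU (eBlock_of_pullK_base G x par C37 C38 h42.1) hM₂ hrepr hM hN
  · -- (3.46): the same members
    intro n lam hh y y' hc hs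
    have e1 := congrFun (congrFun (mK.2.2.2.1 n) lam) hh
    have e2 := congrFun (congrFun (mP.2.2.2.1 n) lam) hh
    rw [e1, ← e2]
    exact h42'.2.1 n lam hh y y' hc hs
  · -- (3.47): the same members
    intro n lam γ h4 h4'
    have e1 := congrFun (congrFun (mK.2.2.2.2 n) lam) γ
    have e2 := congrFun (congrFun (mP.2.2.2.2 n) lam) γ
    rw [e1, ← e2]
    exact h42'.2.2 n lam γ h4 h4'
  · -- (3.43)–(3.45): the same members
    exact ineq343_345_congr G x C37 C38 _ _ (mP.1.trans mK.1.symm) (mP.2.1.trans mK.2.1.symm) (mP.2.2.1.trans mK.2.2.1.symm) Bβ Bε Bεβ δ₀ h43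

end Hin

/-! ## §3 The hypothesis `hin` of the family transfer, literally -/

section HinFamily

open Literature.MathematicalPhysics.QuantumFieldTheory.Balaban1983to89.B6Ineq2142KLevelV1 (β)
open Literature.MathematicalPhysics.QuantumFieldTheory.Balaban1983to89.B9SectBCodedCarrier (CCfg pullK)
open Literature.MathematicalPhysics.QuantumFieldTheory.Balaban1983to89.B9Eq360DeltaPrimeAY (AfldY)
open Literature.MathematicalPhysics.QuantumFieldTheory.Balaban1983to89.B9PinMembersKLevelV1 (MemberY geo9Y bg9Y)
open Literature.MathematicalPhysics.QuantumFieldTheory.Balaban1983to89.B9SectBGpLettersY (GVal)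
open Literature.MathematicalPhysics.QuantumFieldTheory.Balaban1983to89.B9SectBGpFrameCodedY (codingYx)
open Literature.MathematicalPhysics.QuantumFieldTheory.Balaban1983to89.B9SectBGpReadingsY (KSC)
open Literature.MathematicalPhysics.QuantumFieldTheory.Balaban1983to89.Node00 (SiteY BlkY IBondY CfgY SiteParY kernelFamilyS GpY)
open Literature.MathematicalPhysics.QuantumFieldTheory.Balaban1983to89.B9GeoNbrCountKLevelV1 (exists_card_nbr_geo9Y_le_of_M)

variable {d ℓ : ℕ} {hd : 1 ≤ d + 1} {hL : Odd (ℓ + 1) ∧ 1 < ℓ + 1} {b₀ b₁ : ℝ} {Mstar : ℕ} [CompleteSpace 𝔸]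

/-- ★★★ **THE HYPOTHESIS `hin` OF `sectBStepPrinted_of_family`, LITERALLY**, for `Gp₁ := KSC` (augmented readings) and `Gp₂ :=` the record's G′
family read along the decoding, over def-Y's members and the coded carriers: for all input constants there are an M-threshold (the neighbourhood count's
`ML` ∨ `2(d+1)+1`), a vacuous `α₀`-cap `1`, and the constants `(c_in(δ₀)·max B₀ 0, δ₀, B_β, B_ε, B_εβ, B₁, δ₁)` such that at every regular coded
configuration (necessarily `base U` with `U` `G`-valued) the record's block implies the augmented one.  Structural data displayed: `G` of unit norms
(`hG1`), a real basis `b` with coordinate constant `M₂`, block labels `ιB` (sections of `β`).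
[cite: Balaban1985BackgroundPropagators, Thms 3.1–3.3 (3.42)–(3.48) pp.397–399, (3.35) p.396, p.403 l.1–9; Balaban1984PropagatorsII, Lemma 2.1 (2.61) p.234] -/
theorem hin_KSC [∀ x : MemberY d ℓ hd hL b₀ b₁ Mstar, Fintype (geo9Y x).Site] (G : Subgroup 𝔸ˣ) (hG1 : ∀ u : 𝔸ˣ, u ∈ G → ‖(u : 𝔸)‖ ≤ 1)
    (par : ∀ x : MemberY d ℓ hd hL b₀ b₁ Mstar, SiteParY 𝔸 x.toKIdx) {ι : Type} [Fintype ι] (b : Module.Basis ι ℝ 𝔸)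
    {M₂ : ℝ} (hM₂ : 0 ≤ M₂) (hrepr : ∀ (v : 𝔸) (j : ι), |b.repr v j| ≤ M₂ * ‖v‖)
    (ιB : ∀ x : MemberY d ℓ hd hL b₀ b₁ Mstar, BlkY x.toKIdx → IBondY x.toKIdx)
    (hι : ∀ (x : MemberY d ℓ hd hL b₀ b₁ Mstar) (s : BlkY x.toKIdx), β x.toKIdx.hN x.toKIdx.D x.toKIdx.hk (ιB x s) = s)
    (C37 C38 : ∀ x : MemberY d ℓ hd hL b₀ b₁ Mstar, ℝ → CfgY 𝔸 x.toKIdx → AfldY 𝔸 x.toKIdx → Prop) (c35 : ℝ) (dC : ℕ)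
    (GA : ∀ x : MemberY d ℓ hd hL b₀ b₁ Mstar, B9.KernelFamily (geo9Y x) (codingYx G x (C37 x) (C38 x)).bg)
    (Cinv : ∀ x : MemberY d ℓ hd hL b₀ b₁ Mstar, B9.SiteKernel (geo9Y x) (codingYx G x (C37 x) (C38 x)).bg) :
    ∀ (B₀ δ₀ : ℝ) (Bβ Bε : ℝ → ℝ) (Bεβ : ℝ → ℝ → ℝ) (B₁ δ₁ : ℝ),
      ∃ (Mi ai B₀' δ₀' : ℝ) (Bβ' Bε' : ℝ → ℝ) (Bεβ' : ℝ → ℝ → ℝ) (B₁' δ₁' : ℝ), 0 < ai ∧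
        ∀ x : MemberY d ℓ hd hL b₀ b₁ Mstar, Mi ≤ (geo9Y x).M → ∀ α₀ : ℝ, 0 < α₀ → (geo9Y x).M * α₀ ≤ ai →
          ∀ c : (codingYx G x (C37 x) (C38 x)).bg.Cfg, (codingYx G x (C37 x) (C38 x)).bg.Reg335 c35 α₀ c →
          B9.Thms31to33IneqAt dC (pullK (codingYx G x (C37 x) (C38 x))
              (kernelFamilyS x.toKIdx (bg9Y 𝔸 G x) (fun U => U) (GpY x.toKIdx (par x)) (par x))) (GA x) (Cinv x) B₀ δ₀ Bβ Bε Bεβ B₁ δ₁ c →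
          B9.Thms31to33IneqAt dC (KSC G x (par x) (C37 x) (C38 x)) (GA x) (Cinv x) B₀' δ₀' Bβ' Bε' Bεβ' B₁' δ₁' c := by
  intro B₀ δ₀ Bβ Bε Bεβ B₁ δ₁
  obtain ⟨ML, mN, hcnt⟩ := exists_card_nbr_geo9Y_le_of_M (d := d) (ℓ := ℓ) (hd := hd) (hL := hL) (b₀ := b₀) (b₁ := b₁) (2 * ((d : ℝ) + 1))
  refine ⟨max ML (2 * ((d : ℝ) + 1) + 1), 1,
    (((ℓ + 1 : ℕ) : ℝ) * Real.exp (|δ₀| * (2 * ((d : ℝ) + 1))) + ((mN : ℝ) * (M₂ * ∑ j, ‖b j‖) * Real.exp (|δ₀| * (2 * ((d : ℝ) + 1))) + 1))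
      * max B₀ 0, δ₀, Bβ, Bε, Bεβ, B₁, δ₁, one_pos, fun x hM α₀ _ _ c hreg hT => ?_⟩
  obtain ⟨U, rfl, hU335⟩ := (codingYx G x (C37 x) (C38 x)).exists_of_bg_Reg335 hreg
  have hU : GVal G x.toKIdx U := hU335.1.1
  have hM2 : 2 * ((d : ℝ) + 1) < (geo9Y x).M := by
    have := le_trans (le_max_right _ _) hM
    linarith
  have hML : ML ≤ (geo9Y x).M := le_trans (le_max_left _ _) hM
  exact thms_KSC_base_of_pullK G x (par x) b (ιB x) (C37 x) (C38 x) (hι x) hG1 hU hM₂ hrepr hM2 (fun a => hcnt Mstar x hML a) dC (GA x) (Cinv x) hT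

end HinFamily

end Literature.MathematicalPhysics.QuantumFieldTheory.Balaban1983to89.B9SectBGpTransferInY
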